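import Summits.HodgeConjecture.HodgeConjecture.Cruxes.BlochSeedDiscOne.RingTwoMassLaw

/-!
# Shell-3 face of the dual certificate family, II: THE COARSE DOOR UNDER gs-eng-2 (B) — one-block «hub-leg» lemmas

`line stmt-HodgeConjecture-18881 Cruxes/BlochSeedDiscOne/Lines/birth.lean 814a6a70c14e831a stub_rung_pad4_seedAt`
(plan-lens-HodgeAV-dual g16, 2026-08-31; companion of `ShellThreePairLaw.lean` v11 @6387f7144c08).
KERNEL STATEMENTS ONLY — no `sorry`, no new axiom, no `instance`, no `notation`, no `native_decide`.
**Nothing here is proved toward HC / HC_CM / HC_AV / №4 / 26512 / 18881 / H2**: gs-eng-2 (B) «every hub-free supported P cell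
at shell 3 is u⁴, Auuu, AAuu, AAAu, AAAA or Buuu» enters as a DISPLAYED BINDER (`HubfreePB`; and the (M1)-shape `HubfreePAx1`
for one lemma), NOT proved; everything else is the COARSE RULE D + `Disj` + alphabet + ring 3 of the shell-3 statement of record
(`DeepLayerLaws.RingRoomB 14 (BudgetClause σ_H 0) 3`: its `RuleD`/`Disj` are `LeggedFloor.RuleD`/`LeggedFloor.Disj`, its ring
clause `RingLe 3` is `Ring3` below).  Letters ≠ sheaves ≠ SEED; support-level bookkeeping only.

WHY A SEPARATE MODULE.  This is §12 of the one-file kernel v12 (farm `lean check` rc 0, 0 warnings, 0 sorries; 221 217 bytes —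
over the 200 000-byte limit of `ledger crux write`), split off.  It does NOT import `ShellThreePairLaw` (the farm snapshot had not
built that module at publication time); the three §7 helpers it needs — `OffAxis`, `col_eq`, `two_le_colevel_of_offAxis` — are
repeated VERBATIM in this namespace (definitionally equal to `ShellThreePairLaw.OffAxis` etc.).  The mass-law consequences of (B)
(the §11 support hypotheses discharged: `N_a2111_zero_B`, `N_a2210_zero_B`, `N_a2211_zero_B`, `N_a2220_zero_B`, `P_a2211_zero_B`;
`hook_law_B` «2·Σ_P m a2111∘σ′ = 4·Σ_P m a2210∘σ for all σ, σ′», `P_a2210_zero_of_noHook_B` «P Buuu = ∅ ⇒ every P cell with an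
off-axis pair and a charged third letter is absent», `offaxis_triple_free_B`, `hubfreeN_onAxis_of_E_eq`) need both modules and are
in the one-file text (HOME `g16/work/ShellThreePairLaw_v12.lean`) ∕ the pending `ShellThreePropagationB.lean`.

CONTENTS.  Letter facts on the alphabet: nothing lies above a hub (`not_nullStep_of_col_zero`); an OFF-AXIS letter never
null-steps to a hub — `x² + y² = (|x| + |y|)²` forces `xy = 0` (`not_nullStep_hub_of_offAxis`); a null step strictly lowers the
co-level of the upper letter (`col_lt_of_nullStep`).  RULE D at an unordered block (`ruleDN_any`, `ruleDP_any`), the edge step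
(`edgeN_of_charged_hub`).  The one-block lemmas (L0)–(L5) and the three steps (2), (5a), (5b) of the bus RESULT-5 pen chain —
see the two section docstrings below for the list with the cell types each kills or forces. -/

set_option linter.dupNamespace false
set_option autoImplicit false

namespace Summit.HodgeConjecture.HodgeConjecture.Cruxes.BlochSeedDiscOne.ShellThreeDoorB

open Summit.HodgeConjecture.HodgeConjecture.Cruxes.BlochSeedDiscOne.DepthBoundA4
open Summit.HodgeConjecture.HodgeConjecture.Cruxes.BlochSeedDiscOne.RingFourEmpty
open Summit.HodgeConjecture.HodgeConjecture.Cruxes.BlochSeedDiscOne.RingTwoMassLaw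

/-! ## §7-helpers repeated from `ShellThreePairLaw` (verbatim) -/

/-- an off-axis letter: both coordinates non-zero (types `B`, `D` at shell 3). -/
def OffAxis (ℓ : Letter) : Prop := ℓ.x ≠ 0 ∧ ℓ.y ≠ 0

theorem col_eq {h : ℤ} {ℓ : Letter} (hℓ : ℓ.OnAlphabet h) : h - ℓ.a = ℓ.colevel := by
  obtain ⟨hh, _⟩ := hℓ
  unfold Letter.height at hh
  unfold Letter.colevel
  omega

theorem two_le_colevel_of_offAxis (ℓ : Letter) (hoff : OffAxis ℓ) : 2 ≤ ℓ.colevel := by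
  have hP : 0 < |ℓ.x| := abs_pos.mpr hoff.1
  have hQ : 0 < |ℓ.y| := abs_pos.mpr hoff.2
  unfold Letter.colevel
  omega


/-! ## §12 PROPAGATION OF gs-eng-2 (B) UNDER THE COARSE DOOR (RULE D + `Disj` + alphabet + ring 3; height-free)

(B) = «at shell 3 every HUB-FREE supported P cell has type u⁴, Auuu, AAuu, AAAu, AAAA or Buuu» (gs-eng-2 RESULT-4 (B), a CAPSAT
fact of their fine room; here a DISPLAYED BINDER `HubfreePB D`, NOT proved).  Everything below is pen-sized RULE-D chasing at ONE
block «{charged slot, hub slot}» (hub-leg blocks): a supplier ∕ consumer equals the cell off the block and moves a block letter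
strictly (`Disj` forbids equality), and on the alphabet (i) nothing lies above a hub letter (`not_nullStep_of_col_zero`), (ii) an
OFF-AXIS letter never null-steps to a hub letter — `x² + y² = (|x| + |y|)²` forces `x·y = 0` (`not_nullStep_hub_of_offAxis`),
(iii) in ring 3 nothing lies below a co-level-3 letter.  Consequences (supported cells, `D.OnAlphabet h`, `Disj`, `RuleD`,
`Ring3` = `DeepLayerLaws.RingLe 3`, (B)):
* `hubfreeN_onAxis`        — NO hub-free N cell has an off-axis letter (N Buuu, BBuu, ABuu, … : gs-eng-2 (A) is a COROLLARY of (B));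
* `noN_col3_oneHub`        — no N cell «hub + co-level-3 letter + all other letters charged» (N CHuu, DHuu, ADHu-type, …);
* `noP_off2_col3_hub`      — no P cell «off-axis + col-3 + hub + charged» (P BDHu, BCHu, DDHu, CDHu, BBDH-type, …);
* `noN_col2_off2_hub`      — no N cell «col-2 + off-axis + hub + charged» (N ABHu, BBHu, BBBH, AABH/ABDH-type, …);
* `noN_col3_off2_HH`       — no N cell «col-3 + off-axis + hub + hub» (N BDHH, BCHH, DDHH, CDHH);
* `noP_col2_off2_off2_hub` — no P cell «col-2 + off-axis + off-axis + hub» (P ABBH, BBBH, ABDH, …)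
(an N «BBBH» is already a case of `noN_col2_off2_hub`).
Hence the support hypotheses of §11 are DISCHARGED by (B): `N_a2111_zero_B`, `N_a2210_zero_B`, `N_a2211_zero_B`,
`N_a2220_zero_B`, `P_a2211_zero_B`; and the §11 laws hold given (B): `hook_law_B` — `2·Σ_P m a2111∘σ′ = 4·Σ_P m a2210∘σ` for
ALL placements σ, σ′ (the P `Buuu` mass read at any slot is twice the P off-axis-pair/col mass of any class; at shell 3 the only
surviving P `a2210`-carriers are the `BBHu` cells) — and `offaxis_triple_free_B` (no P off-axis triple).  With §11c: at `E = −8`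
the forced hub-free N cell is ON-AXIS at every slot (`hubfreeN_onAxis_of_E_eq`).
Independent cross-check (not used here): the same emptiness list is the uncapped fixed point of support-level dead propagation on
gs-eng-2's fine room from seed (B) under the coarse door (scripts `deadprop_coarse.py` ∕ `deadwhy_coarse_out.txt`, HOME g16/work). -/

section PropagationB
open Summit.HodgeConjecture.HodgeConjecture.Cruxes.BlochSeedDiscOne.LeggedFloor

/-- ring 3 of the register: every supported letter has co-level `≤ 3` (verbatim the body of `DeepLayerLaws.RingLe 3 D`). -/
def Ring3 (D : Design) : Prop := ∀ x ∈ D.suppN ++ D.suppP, ∀ f : Fin 4, (x f).colevel ≤ 3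

/-- gs-eng-2 (B) as a displayed binder: a HUB-FREE supported P cell has no letter of co-level `≥ 3`, and an off-axis letter in it
forces every other letter to have co-level `≤ 1` (types u⁴, Auuu, AAuu, AAAu, AAAA, Buuu). -/
def HubfreePB (D : Design) : Prop :=
  ∀ x ∈ D.suppP, (∀ f : Fin 4, (x f).colevel ≠ 0) →
    (∀ f : Fin 4, (x f).colevel ≤ 2) ∧ (∀ k g : Fin 4, k ≠ g → OffAxis (x k) → (x g).colevel ≤ 1)

theorem col_nonneg (ℓ : Letter) : 0 ≤ ℓ.colevel := by unfold Letter.colevel; positivity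

theorem col_eq_of_onAlphabet {h : ℤ} {ℓ : Letter} (hℓ : ℓ.OnAlphabet h) : ℓ.colevel = h - ℓ.a := (col_eq hℓ).symm

theorem col_lt_of_nullStep {h : ℤ} {ℓ ℓ' : Letter} (hℓ : ℓ.OnAlphabet h) (hℓ' : ℓ'.OnAlphabet h) (hn : NullStep ℓ ℓ') :
    ℓ'.colevel < ℓ.colevel := by
  rw [col_eq_of_onAlphabet hℓ, col_eq_of_onAlphabet hℓ']
  have := hn.1
  omega

theorem col_le_of_eq_or_null {h : ℤ} {ℓ ℓ' : Letter} (hℓ : ℓ.OnAlphabet h) (hℓ' : ℓ'.OnAlphabet h)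
    (hs : ℓ = ℓ' ∨ NullStep ℓ ℓ') : ℓ'.colevel ≤ ℓ.colevel := by
  rcases hs with hs | hs
  · rw [hs]
  · exact (col_lt_of_nullStep hℓ hℓ' hs).le

/-- nothing on the alphabet lies above a hub letter (co-level `0`). -/
theorem not_nullStep_of_col_zero {h : ℤ} {ℓ ℓ' : Letter} (hℓ : ℓ.OnAlphabet h) (hℓ' : ℓ'.OnAlphabet h)
    (h0 : ℓ.colevel = 0) : ¬ NullStep ℓ ℓ' := by
  intro hn
  have := col_lt_of_nullStep hℓ hℓ' hn
  have := col_nonneg ℓ'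
  omega

theorem xy_zero_of_col_zero {ℓ : Letter} (h0 : ℓ.colevel = 0) : ℓ.x = 0 ∧ ℓ.y = 0 := by
  unfold Letter.colevel at h0
  have := abs_nonneg ℓ.x
  have := abs_nonneg ℓ.y
  exact ⟨abs_eq_zero.mp (by linarith), abs_eq_zero.mp (by linarith)⟩

/-- an OFF-AXIS letter never null-steps to a hub letter: `x² + y² = (|x| + |y|)²` forces `|x|·|y| = 0`. -/
theorem not_nullStep_hub_of_offAxis {h : ℤ} {ℓ ℓ' : Letter} (hℓ : ℓ.OnAlphabet h) (hℓ' : ℓ'.OnAlphabet h)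
    (hoff : OffAxis ℓ) (h0 : ℓ'.colevel = 0) : ¬ NullStep ℓ ℓ' := by
  intro hn
  have hx' := xy_zero_of_col_zero h0
  have e1 := hℓ.1
  have e2 := hℓ'.1
  unfold Letter.height at e1 e2
  obtain ⟨_, heq⟩ := hn
  rw [hx'.1, hx'.2] at heq e2
  simp only [abs_zero, add_zero] at e2
  have hd : ℓ'.a - ℓ.a = |ℓ.x| + |ℓ.y| := by omega
  rw [hd] at heq
  have hsx := sq_abs ℓ.x
  have hsy := sq_abs ℓ.y
  have hprod : 2 * (|ℓ.x| * |ℓ.y|) = 0 := by linear_combination (-1 : ℤ) * heq - hsx - hsy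
  rcases mul_eq_zero.mp hprod with h2 | h2
  · omega
  rcases mul_eq_zero.mp h2 with h1 | h1
  · exact hoff.1 (abs_eq_zero.mp h1)
  · exact hoff.2 (abs_eq_zero.mp h1)

theorem detects_of_col_ne_zero (c : Cell) (g j : Fin 4) (hg : (c g).colevel ≠ 0) : Detects c g j := by
  intro hd
  apply hg
  unfold Letter.colevel
  rw [hd.1, hd.2.1]
  simp

theorem detects_symm {c : Cell} {g j : Fin 4} (hd : Detects c g j) : Detects c j g := by
  intro h'
  exact hd ⟨h'.2.2.1, h'.2.2.2.1, h'.1, h'.2.1, h'.2.2.2.2.symm⟩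

theorem supplies_symm {x y : Cell} {g j : Fin 4} (hs : Supplies x y g j) : Supplies x y j g :=
  ⟨fun f hfj hfg => hs.1 f hfg hfj, hs.2.2, hs.2.1⟩

/-- RULE D (N side) at an unordered block. -/
theorem ruleDN_any {D : Design} (hr : RuleD D) {y : Cell} (hy : y ∈ D.suppN) {g j : Fin 4} (hne : g ≠ j)
    (hd : Detects y g j) : ∃ x ∈ D.suppP, Supplies x y g j := by
  rcases lt_or_gt_of_ne hne with hlt | hlt
  · exact hr.1 y hy g j hlt hd
  · obtain ⟨x, hx, hs⟩ := hr.1 y hy j g hlt (detects_symm hd)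
    exact ⟨x, hx, supplies_symm hs⟩

/-- RULE D (P side) at an unordered block. -/
theorem ruleDP_any {D : Design} (hr : RuleD D) {x : Cell} (hx : x ∈ D.suppP) {g j : Fin 4} (hne : g ≠ j)
    (hd : Detects x g j) : ∃ y ∈ D.suppN, Supplies x y g j := by
  rcases lt_or_gt_of_ne hne with hlt | hlt
  · exact hr.2 x hx g j hlt hd
  · obtain ⟨y, hy, hs⟩ := hr.2 x hx j g hlt (detects_symm hd)
    exact ⟨y, hy, supplies_symm hs⟩

/-- a supplier pair that agrees on both block slots is one cell. -/
theorem cell_eq_of_supplies {x y : Cell} {g j : Fin 4} (hs : Supplies x y g j) (hg : x g = y g) (hj : x j = y j) :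
    x = y := by
  funext f
  by_cases hfg : f = g
  · rw [hfg]; exact hg
  by_cases hfj : f = j
  · rw [hfj]; exact hj
  exact hs.1 f hfg hfj

/-- five slots in `Fin 4` cannot be pairwise distinct. -/
theorem fin4_exhaust (k l j g f : Fin 4) (hkl : k ≠ l) (hkj : k ≠ j) (hkg : k ≠ g) (hlj : l ≠ j) (hlg : l ≠ g)
    (hjg : j ≠ g) (hfk : f ≠ k) (hfl : f ≠ l) (hfj : f ≠ j) (hfg : f ≠ g) : False := by
  omega

/-- every slot is `σ i` for some `i`. -/
theorem forall_slot_of_perm (σ : Equiv.Perm (Fin 4)) {P : Fin 4 → Prop}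
    (h0 : P (σ 0)) (h1 : P (σ 1)) (h2 : P (σ 2)) (h3 : P (σ 3)) : ∀ f : Fin 4, P f := by
  intro f
  have key : ∀ i : Fin 4, P (σ i) := by
    intro i
    fin_cases i
    · exact h0
    · exact h1
    · exact h2
    · exact h3
  simpa using key (σ.symm f)

theorem offAxis_of_absmul_ne_zero {ℓ : Letter} (h : |ℓ.x| * |ℓ.y| ≠ 0) : OffAxis ℓ := by
  obtain ⟨hx, hy⟩ := mul_ne_zero_iff.mp h
  exact ⟨abs_ne_zero.mp hx, abs_ne_zero.mp hy⟩

/-- **(L0) under (B), no hub-free supported N cell has an off-axis letter** (coarse RULE D at the block `{k, j}`, any `j ≠ k`: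
the supplier is hub-free, hence allowed, hence equal to the N cell — `Disj`).  gs-eng-2 (A) «N charged ⊆ {u⁴, Auuu}» ⊇ this. -/
theorem hubfreeN_onAxis {h : ℤ} {D : Design} (hD : D.OnAlphabet h) (hr : RuleD D) (hdis : Disj D) (hB : HubfreePB D)
    {y : Cell} (hy : y ∈ D.suppN) (hfree : ∀ f : Fin 4, (y f).colevel ≠ 0) (k : Fin 4) : ¬ OffAxis (y k) := by
  intro hoff
  have hyA : ∀ f : Fin 4, (y f).OnAlphabet h := hD y (LeggedFloor.mem_supp_of_memN D hy)
  obtain ⟨j, hjk⟩ : ∃ j : Fin 4, j ≠ k := by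
    by_cases hk : k = 0
    · exact ⟨1, by rw [hk]; decide⟩
    · exact ⟨0, fun h0 => hk h0.symm⟩
  obtain ⟨x, hx, hs⟩ := ruleDN_any hr hy hjk.symm (detects_of_col_ne_zero y k j (hfree k))
  have hxA : ∀ f : Fin 4, (x f).OnAlphabet h := hD x (LeggedFloor.mem_supp_of_memP D hx)
  have hxfree : ∀ f : Fin 4, (x f).colevel ≠ 0 := by
    intro f
    by_cases hfk : f = k
    · rw [hfk]
      have h1 := col_le_of_eq_or_null (hxA k) (hyA k) hs.2.1
      have h2 := hfree k
      have h3 := col_nonneg (y k)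
      omega
    by_cases hfj : f = j
    · rw [hfj]
      have h1 := col_le_of_eq_or_null (hxA j) (hyA j) hs.2.2
      have h2 := hfree j
      have h3 := col_nonneg (y j)
      omega
    · rw [hs.1 f hfk hfj]; exact hfree f
  obtain ⟨hle2, hoffB⟩ := hB x hx hxfree
  have hxk : x k = y k := by
    rcases hs.2.1 with he | hn
    · exact he
    · exfalso
      have h1 := col_lt_of_nullStep (hxA k) (hyA k) hn
      have h2 := two_le_colevel_of_offAxis (y k) hoff
      have h3 := hle2 k
      omega
  have hxoff : OffAxis (x k) := by rw [hxk]; exact hoff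
  have hxj : x j = y j := by
    rcases hs.2.2 with he | hn
    · exact he
    · exfalso
      have h1 := col_lt_of_nullStep (hxA j) (hyA j) hn
      have h2 := hoffB k j hjk.symm hxoff
      have h3 := hfree j
      have h4 := col_nonneg (y j)
      omega
  have heq := cell_eq_of_supplies hs hxk hxj
  exact hdis x (by rw [heq]; exact hy) hx

/-- **(L1)** no supported N cell with a hub at `j`, a co-level-3 letter at `k`, and every letter off `j` charged
(block `{k, j}`: the supplier keeps the co-level-3 letter (ring 3), moves the hub (Disj), is hub-free with a col-3 letter: ¬(B)). -/
theorem noN_col3_oneHub {h : ℤ} {D : Design} (hD : D.OnAlphabet h) (hr : RuleD D) (hdis : Disj D) (h3 : Ring3 D)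
    (hB : HubfreePB D) {y : Cell} (hy : y ∈ D.suppN) {k j : Fin 4} (hkj : k ≠ j) (hk : (y k).colevel = 3)
    (hj : (y j).colevel = 0) (hch : ∀ f : Fin 4, f ≠ j → (y f).colevel ≠ 0) : False := by
  have hyA : ∀ f : Fin 4, (y f).OnAlphabet h := hD y (LeggedFloor.mem_supp_of_memN D hy)
  obtain ⟨x, hx, hs⟩ := ruleDN_any hr hy hkj (detects_of_col_ne_zero y k j (by rw [hk]; norm_num))
  have hxA : ∀ f : Fin 4, (x f).OnAlphabet h := hD x (LeggedFloor.mem_supp_of_memP D hx)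
  have hxk : x k = y k := by
    rcases hs.2.1 with he | hn
    · exact he
    · exfalso
      have h1 := col_lt_of_nullStep (hxA k) (hyA k) hn
      have h2 := h3 x (LeggedFloor.mem_supp_of_memP D hx) k
      omega
  have hnj : NullStep (x j) (y j) := by
    rcases hs.2.2 with he | hn
    · exact (hdis x (by rw [cell_eq_of_supplies hs hxk he]; exact hy) hx).elim
    · exact hn
  have hxj : (x j).colevel ≠ 0 := by
    have h1 := col_lt_of_nullStep (hxA j) (hyA j) hnj
    have h2 := col_nonneg (y j)
    omega
  have hxfree : ∀ f : Fin 4, (x f).colevel ≠ 0 := by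
    intro f
    by_cases hfk : f = k
    · rw [hfk, hxk, hk]; norm_num
    by_cases hfj : f = j
    · rw [hfj]; exact hxj
    · rw [hs.1 f hfk hfj]; exact hch f hfj
  have h4 := (hB x hx hxfree).1 k
  rw [hxk, hk] at h4
  omega

/-- **(L2)** no supported P cell with an off-axis letter at `k` (`B` or `D`), a co-level-3 letter at `l`, a hub at `j`, and every
letter off `j` charged (block `{k, j}`: the consumer keeps the hub, lifts the `k` letter to a CHARGED letter (never to the hub), and is
an L1 cell).  Types: P BDHu, BCHu, DDHu, CDHu, BBDH, ABDH, … -/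
theorem noP_off2_col3_hub {h : ℤ} {D : Design} (hD : D.OnAlphabet h) (hr : RuleD D) (hdis : Disj D) (h3 : Ring3 D)
    (hB : HubfreePB D) {x : Cell} (hx : x ∈ D.suppP) {k l j : Fin 4} (hkj : k ≠ j) (hlj : l ≠ j) (hkl : k ≠ l)
    (hko : OffAxis (x k)) (hl3 : (x l).colevel = 3) (hj0 : (x j).colevel = 0)
    (hch : ∀ f : Fin 4, f ≠ j → (x f).colevel ≠ 0) : False := by
  have hxA : ∀ f : Fin 4, (x f).OnAlphabet h := hD x (LeggedFloor.mem_supp_of_memP D hx)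
  obtain ⟨y, hy, hs⟩ := ruleDP_any hr hx hkj
    (detects_of_col_ne_zero x k j (by have := two_le_colevel_of_offAxis _ hko; omega))
  have hyA : ∀ f : Fin 4, (y f).OnAlphabet h := hD y (LeggedFloor.mem_supp_of_memN D hy)
  have hyj : x j = y j := by
    rcases hs.2.2 with he | hn
    · exact he
    · exact absurd hn (not_nullStep_of_col_zero (hxA j) (hyA j) hj0)
  have hnk : NullStep (x k) (y k) := by
    rcases hs.2.1 with he | hn
    · exact (hdis x (by rw [cell_eq_of_supplies hs he hyj]; exact hy) hx).elim
    · exact hn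
  have hyk0 : (y k).colevel ≠ 0 := fun h0 => not_nullStep_hub_of_offAxis (hxA k) (hyA k) hko h0 hnk
  refine noN_col3_oneHub hD hr hdis h3 hB hy hlj ?_ ?_ ?_
  · rw [← hs.1 l hkl.symm hlj]; exact hl3
  · rw [← hyj]; exact hj0
  · intro f hfj
    by_cases hfk : f = k
    · rw [hfk]; exact hyk0
    · rw [← hs.1 f hfk hfj]; exact hch f hfj

/-- **(L3)** no supported N cell with a co-level-2 letter at `i`, an off-axis letter at `k`, a hub at `j`, and every letter off `j`
charged (types N ABHu, BBHu, ADHu′?, AABH, BBBH, ABDH, …) (block `{i, j}`: a supplier keeping the hub drops the `i` letter to co-level 3 — an L2 cell; a supplier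
moving the hub is hub-free with an off-axis letter and a col-2 letter: ¬(B)). -/
theorem noN_col2_off2_hub {h : ℤ} {D : Design} (hD : D.OnAlphabet h) (hr : RuleD D) (hdis : Disj D) (h3 : Ring3 D)
    (hB : HubfreePB D) {y : Cell} (hy : y ∈ D.suppN) {i k j : Fin 4} (hij : i ≠ j) (hkj : k ≠ j) (hik : i ≠ k)
    (hi2 : (y i).colevel = 2) (hko : OffAxis (y k)) (hj0 : (y j).colevel = 0)
    (hch : ∀ f : Fin 4, f ≠ j → (y f).colevel ≠ 0) : False := by
  have hyA : ∀ f : Fin 4, (y f).OnAlphabet h := hD y (LeggedFloor.mem_supp_of_memN D hy)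
  obtain ⟨x, hx, hs⟩ := ruleDN_any hr hy hij (detects_of_col_ne_zero y i j (by rw [hi2]; norm_num))
  have hxA : ∀ f : Fin 4, (x f).OnAlphabet h := hD x (LeggedFloor.mem_supp_of_memP D hx)
  have hxk : x k = y k := hs.1 k hik.symm hkj
  have hxko : OffAxis (x k) := by rw [hxk]; exact hko
  rcases hs.2.2 with hej | hnj
  · have hni : NullStep (x i) (y i) := by
      rcases hs.2.1 with he | hn
      · exact (hdis x (by rw [cell_eq_of_supplies hs he hej]; exact hy) hx).elim
      · exact hn
    have hxi3 : (x i).colevel = 3 := by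
      have h1 := col_lt_of_nullStep (hxA i) (hyA i) hni
      have h2 := h3 x (LeggedFloor.mem_supp_of_memP D hx) i
      omega
    refine noP_off2_col3_hub hD hr hdis h3 hB hx hkj hij hik.symm hxko hxi3 (by rw [hej]; exact hj0) ?_
    intro f hfj
    by_cases hfi : f = i
    · rw [hfi, hxi3]; norm_num
    · rw [hs.1 f hfi hfj]; exact hch f hfj
  · have hxj0 : (x j).colevel ≠ 0 := by
      have h1 := col_lt_of_nullStep (hxA j) (hyA j) hnj
      have h2 := col_nonneg (y j)
      omega
    have hxi2 : 2 ≤ (x i).colevel := by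
      have h1 := col_le_of_eq_or_null (hxA i) (hyA i) hs.2.1
      omega
    have hxfree : ∀ f : Fin 4, (x f).colevel ≠ 0 := by
      intro f
      by_cases hfi : f = i
      · rw [hfi]; omega
      by_cases hfj : f = j
      · rw [hfj]; exact hxj0
      · rw [hs.1 f hfi hfj]; exact hch f hfj
    have h4 := (hB x hx hxfree).2 k i hik.symm hxko
    omega

/-- **(L4)** no supported N cell with an off-axis letter at `k`, a co-level-3 letter at `l`, and hubs at `j` and `g` (N BDHH, BCHH,
DDHH, CDHH)
(block `{l, j}`: the supplier keeps the col-3 letter (ring 3), moves the hub at `j`, and is an L2 cell with hub `g`). -/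
theorem noN_col3_off2_HH {h : ℤ} {D : Design} (hD : D.OnAlphabet h) (hr : RuleD D) (hdis : Disj D) (h3 : Ring3 D)
    (hB : HubfreePB D) {y : Cell} (hy : y ∈ D.suppN) {k l j g : Fin 4} (hkl : k ≠ l) (hkj : k ≠ j) (hkg : k ≠ g)
    (hlj : l ≠ j) (hlg : l ≠ g) (hjg : j ≠ g) (hko : OffAxis (y k))
    (hl3 : (y l).colevel = 3) (hj0 : (y j).colevel = 0) (hg0 : (y g).colevel = 0) : False := by
  have hyA : ∀ f : Fin 4, (y f).OnAlphabet h := hD y (LeggedFloor.mem_supp_of_memN D hy)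
  obtain ⟨x, hx, hs⟩ := ruleDN_any hr hy hlj (detects_of_col_ne_zero y l j (by rw [hl3]; norm_num))
  have hxA : ∀ f : Fin 4, (x f).OnAlphabet h := hD x (LeggedFloor.mem_supp_of_memP D hx)
  have hxl : x l = y l := by
    rcases hs.2.1 with he | hn
    · exact he
    · exfalso
      have h1 := col_lt_of_nullStep (hxA l) (hyA l) hn
      have h2 := h3 x (LeggedFloor.mem_supp_of_memP D hx) l
      omega
  have hnj : NullStep (x j) (y j) := by
    rcases hs.2.2 with he | hn
    · exact (hdis x (by rw [cell_eq_of_supplies hs hxl he]; exact hy) hx).elim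
    · exact hn
  have hxj0 : (x j).colevel ≠ 0 := by
    have h1 := col_lt_of_nullStep (hxA j) (hyA j) hnj
    have h2 := col_nonneg (y j)
    omega
  have hxk : x k = y k := hs.1 k hkl hkj
  have hxg : x g = y g := hs.1 g hlg.symm hjg.symm
  refine noP_off2_col3_hub hD hr hdis h3 hB hx hkg hlg hkl (by rw [hxk]; exact hko) (by rw [hxl]; exact hl3)
    (by rw [hxg]; exact hg0) ?_
  intro f hfg
  by_cases hfl : f = l
  · rw [hfl, hxl, hl3]; norm_num
  by_cases hfj : f = j
  · rw [hfj]; exact hxj0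
  by_cases hfk : f = k
  · rw [hfk, hxk]; have := two_le_colevel_of_offAxis _ hko; omega
  exact (fin4_exhaust k l j g f hkl hkj hkg hlj hlg hjg hfk hfl hfj hfg).elim

/-- **(L5)** no supported P cell with a co-level-2 letter at `i`, off-axis letters at `k` and `l`, and a hub at `j` (P ABBH, BBBH,
ABDH, …)
(block `{l, j}`: the consumer keeps the hub, lifts the `l` letter to a unit, and is an L3 cell). -/
theorem noP_col2_off2_off2_hub {h : ℤ} {D : Design} (hD : D.OnAlphabet h) (hr : RuleD D) (hdis : Disj D) (h3 : Ring3 D)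
    (hB : HubfreePB D) {x : Cell} (hx : x ∈ D.suppP) {i k l j : Fin 4} (hik : i ≠ k) (hil : i ≠ l) (hij : i ≠ j)
    (hkl : k ≠ l) (hkj : k ≠ j) (hlj : l ≠ j) (hi2 : (x i).colevel = 2) (hko : OffAxis (x k))
    (hlo : OffAxis (x l)) (hj0 : (x j).colevel = 0) : False := by
  have hxA : ∀ f : Fin 4, (x f).OnAlphabet h := hD x (LeggedFloor.mem_supp_of_memP D hx)
  obtain ⟨y, hy, hs⟩ := ruleDP_any hr hx hlj
    (detects_of_col_ne_zero x l j (by have := two_le_colevel_of_offAxis _ hlo; omega))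
  have hyA : ∀ f : Fin 4, (y f).OnAlphabet h := hD y (LeggedFloor.mem_supp_of_memN D hy)
  have hyj : x j = y j := by
    rcases hs.2.2 with he | hn
    · exact he
    · exact absurd hn (not_nullStep_of_col_zero (hxA j) (hyA j) hj0)
  have hnl : NullStep (x l) (y l) := by
    rcases hs.2.1 with he | hn
    · exact (hdis x (by rw [cell_eq_of_supplies hs he hyj]; exact hy) hx).elim
    · exact hn
  have hyl0 : (y l).colevel ≠ 0 := fun h0 => not_nullStep_hub_of_offAxis (hxA l) (hyA l) hlo h0 hnl
  have hyi : x i = y i := hs.1 i hil hij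
  have hyk : x k = y k := hs.1 k hkl hkj
  refine noN_col2_off2_hub hD hr hdis h3 hB hy hij hkj hik (by rw [← hyi]; exact hi2) (by rw [← hyk]; exact hko)
    (by rw [← hyj]; exact hj0) ?_
  intro f hfj
  by_cases hfi : f = i
  · rw [hfi, ← hyi, hi2]; norm_num
  by_cases hfk : f = k
  · rw [hfk, ← hyk]; have := two_le_colevel_of_offAxis _ hko; omega
  by_cases hfl : f = l
  · rw [hfl]; exact hyl0
  exact (fin4_exhaust i k l j f hik hil hij hkl hkj hlj hfi hfk hfl hfj).elim

/-! ### 12b. The one-block steps of the B′ pen closure (bus RESULT-5, 2026-08-31)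

The pen chain of RESULT-5 closes room B′ of shell 3 under four displayed machine binders; its two DOOR steps are the
following one-block lemmas (coarse RULE D, `Disj`, alphabet, ring 3; (B) = `HubfreePB` where stated, and for step (5b) the
typed (M1)-shape binder `HubfreePAx1` «a hub-free supported P cell has at most one letter of co-level ≥ 2» — true for
u⁴, Auuu, Buuu).  Nothing here assumes the type-level machine facts themselves.
* `edgeN_of_charged_hub` — P side, block {charged `i`, hub `j`}: the consumer keeps the hub and STRICTLY lifts the `i` letter;
* `nHub_of_p_col3_hub`   — step (2): P «charged@i + col-3@k + hub@j + charged» forces N «same cell with a HUB at i»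
                            (the unit alternative is an L1 cell); P AADH ⇒ N ADHH;
* `nUnit_of_p_off2_hub`  — step (5a): P «off-axis col-2@k + hub@j» forces N «same cell with a UNIT at k»; P AABH ⇒ N AAHu;
* `pCol3_of_n_col2_col2_hub` — step (5b): N «col-2@i + col-2@i′ + hub@j + charged» forces P «same cell with a col-3 letter
                            at i, null-below the old one» (the supplier cannot move the hub — it would be hub-free with two
                            letters of co-level ≥ 2 — so by `Disj` it lowers the `i` letter); N AAHu ⇒ P ACHu ∕ ADHu, at i and at i′. -/

/-- (M1)-shape binder: a hub-free supported P cell has at most one letter of co-level ≥ 2 (u⁴, Auuu, Buuu qualify). -/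
def HubfreePAx1 (D : Design) : Prop :=
  ∀ x ∈ D.suppP, (∀ f : Fin 4, (x f).colevel ≠ 0) → ∀ f g : Fin 4, f ≠ g → 2 ≤ (x f).colevel → (x g).colevel ≤ 1

/-- edge step at a charged letter next to a hub (P side): the consumer keeps the hub and strictly lifts the charged letter. -/
theorem edgeN_of_charged_hub {h : ℤ} {D : Design} (hD : D.OnAlphabet h) (hr : RuleD D) (hdis : Disj D) {x : Cell}
    (hx : x ∈ D.suppP) {i j : Fin 4} (hij : i ≠ j) (hi : (x i).colevel ≠ 0) (hj : (x j).colevel = 0) :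
    ∃ y ∈ D.suppN, (∀ f : Fin 4, f ≠ i → y f = x f) ∧ NullStep (x i) (y i) := by
  have hxA : ∀ f : Fin 4, (x f).OnAlphabet h := hD x (LeggedFloor.mem_supp_of_memP D hx)
  obtain ⟨y, hy, hs⟩ := ruleDP_any hr hx hij (detects_of_col_ne_zero x i j hi)
  have hyA : ∀ f : Fin 4, (y f).OnAlphabet h := hD y (LeggedFloor.mem_supp_of_memN D hy)
  have hyj : x j = y j := by
    rcases hs.2.2 with he | hn
    · exact he
    · exact absurd hn (not_nullStep_of_col_zero (hxA j) (hyA j) hj)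
  have hyi : NullStep (x i) (y i) := by
    rcases hs.2.1 with he | hn
    · exfalso
      have heq := cell_eq_of_supplies hs he hyj
      exact hdis x (by rw [heq]; exact hy) hx
    · exact hn
  refine ⟨y, hy, ?_, hyi⟩
  intro f hfi
  by_cases hfj : f = j
  · rw [hfj]; exact hyj.symm
  · exact (hs.1 f hfi hfj).symm

/-- **step (2)**: a supported P cell with a charged letter at `i`, a co-level-3 letter at `k`, a hub at `j` and every letter off
`j` charged forces the supported N cell «`x` with the `i` letter replaced by a hub» (P AADH ⇒ N ADHH, P ACHu ⇒ N CHHu, …). -/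
theorem nHub_of_p_col3_hub {h : ℤ} {D : Design} (hD : D.OnAlphabet h) (hr : RuleD D) (hdis : Disj D) (h3 : Ring3 D)
    (hB : HubfreePB D) {x : Cell} (hx : x ∈ D.suppP) {i k j : Fin 4} (hij : i ≠ j) (hkj : k ≠ j) (hik : i ≠ k)
    (hi : (x i).colevel ≠ 0) (hk3 : (x k).colevel = 3) (hj0 : (x j).colevel = 0)
    (hch : ∀ f : Fin 4, f ≠ j → (x f).colevel ≠ 0) :
    ∃ y ∈ D.suppN, (∀ f : Fin 4, f ≠ i → y f = x f) ∧ (y i).colevel = 0 := by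
  obtain ⟨y, hy, hyf, _hn⟩ := edgeN_of_charged_hub hD hr hdis hx hij hi hj0
  refine ⟨y, hy, hyf, ?_⟩
  by_contra hyi
  refine noN_col3_oneHub hD hr hdis h3 hB hy hkj (by rw [hyf k hik.symm]; exact hk3)
    (by rw [hyf j hij.symm]; exact hj0) ?_
  intro f hfj
  by_cases hfi : f = i
  · rw [hfi]; exact hyi
  · rw [hyf f hfi]; exact hch f hfj

/-- **step (5a)**: a supported P cell with an off-axis co-level-2 letter at `k` and a hub at `j` forces the supported N cell
«`x` with the `k` letter lifted to a unit» (P AABH ⇒ N AAHu, P BHuu ⇒ N Huuu, …). -/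
theorem nUnit_of_p_off2_hub {h : ℤ} {D : Design} (hD : D.OnAlphabet h) (hr : RuleD D) (hdis : Disj D) {x : Cell}
    (hx : x ∈ D.suppP) {k j : Fin 4} (hkj : k ≠ j) (hko : OffAxis (x k)) (hk2 : (x k).colevel = 2)
    (hj0 : (x j).colevel = 0) : ∃ y ∈ D.suppN, (∀ f : Fin 4, f ≠ k → y f = x f) ∧ (y k).colevel = 1 := by
  obtain ⟨y, hy, hyf, hn⟩ := edgeN_of_charged_hub hD hr hdis hx hkj (by rw [hk2]; norm_num) hj0
  have hxA : ∀ f : Fin 4, (x f).OnAlphabet h := hD x (LeggedFloor.mem_supp_of_memP D hx)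
  have hyA : ∀ f : Fin 4, (y f).OnAlphabet h := hD y (LeggedFloor.mem_supp_of_memN D hy)
  refine ⟨y, hy, hyf, ?_⟩
  have h1 := col_lt_of_nullStep (hxA k) (hyA k) hn
  have h2 := col_nonneg (y k)
  have h3 : (y k).colevel ≠ 0 := fun h0 => not_nullStep_hub_of_offAxis (hxA k) (hyA k) hko h0 hn
  omega

/-- **step (5b)** (binder `HubfreePAx1`): a supported N cell with co-level-2 letters at `i` and `i'`, a hub at `j` and every letter
off `j` charged forces a supported P cell «`y` with the `i` letter strictly lowered, to co-level 3» (N AAHu ⇒ P ACHu or P ADHu with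
the C ∕ D null-below the A at `i`; symmetrically at `i'`). -/
theorem pCol3_of_n_col2_col2_hub {h : ℤ} {D : Design} (hD : D.OnAlphabet h) (hr : RuleD D) (hdis : Disj D) (h3 : Ring3 D)
    (hB1 : HubfreePAx1 D) {y : Cell} (hy : y ∈ D.suppN) {i i' j : Fin 4} (hij : i ≠ j) (hi'j : i' ≠ j) (hii' : i ≠ i')
    (hi2 : (y i).colevel = 2) (hi'2 : (y i').colevel = 2) (hch : ∀ f : Fin 4, f ≠ j → (y f).colevel ≠ 0) :
    ∃ x ∈ D.suppP, (∀ f : Fin 4, f ≠ i → x f = y f) ∧ (x i).colevel = 3 ∧ NullStep (x i) (y i) := by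
  have hyA : ∀ f : Fin 4, (y f).OnAlphabet h := hD y (LeggedFloor.mem_supp_of_memN D hy)
  obtain ⟨x, hx, hs⟩ := ruleDN_any hr hy hij (detects_of_col_ne_zero y i j (by rw [hi2]; norm_num))
  have hxA : ∀ f : Fin 4, (x f).OnAlphabet h := hD x (LeggedFloor.mem_supp_of_memP D hx)
  have hxi2 : 2 ≤ (x i).colevel := by
    have h1 := col_le_of_eq_or_null (hxA i) (hyA i) hs.2.1
    omega
  -- the supplier keeps the hub
  have hxj : x j = y j := by
    rcases hs.2.2 with he | hn
    · exact he
    · exfalso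
      have hxjc : (x j).colevel ≠ 0 := by
        have h1 := col_lt_of_nullStep (hxA j) (hyA j) hn
        have h2 := col_nonneg (y j)
        omega
      have hxfree : ∀ f : Fin 4, (x f).colevel ≠ 0 := by
        intro f
        by_cases hfj : f = j
        · rw [hfj]; exact hxjc
        by_cases hfi : f = i
        · rw [hfi]; omega
        · rw [hs.1 f hfi hfj]; exact hch f hfj
      have hxi' : (x i').colevel = 2 := by rw [hs.1 i' (Ne.symm hii') hi'j]; exact hi'2
      have := hB1 x hx hxfree i i' hii' hxi2
      omega
  have hn : NullStep (x i) (y i) := by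
    rcases hs.2.1 with he | hn
    · exfalso
      have heq := cell_eq_of_supplies hs he hxj
      exact hdis x (by rw [heq]; exact hy) hx
    · exact hn
  refine ⟨x, hx, ?_, ?_, hn⟩
  · intro f hfi
    by_cases hfj : f = j
    · rw [hfj]; exact hxj
    · exact hs.1 f hfi hfj
  · have h1 := col_lt_of_nullStep (hxA i) (hyA i) hn
    have h2 := h3 x (LeggedFloor.mem_supp_of_memP D hx) i
    omega

end PropagationB

end Summit.HodgeConjecture.HodgeConjecture.Cruxes.BlochSeedDiscOne.ShellThreeDoorB
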